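import Mathlib
import Summits.ResolutionOfSingularities.ResolutionOfSingularities.Theorems.RadicialJungCleanModelsCleanLU3CompositeResidue
import Summits.ResolutionOfSingularities.ResolutionOfSingularities.Theorems.RadicialJungCleanModelsCleanLU3CompositeGlueOne
import Summits.ResolutionOfSingularities.ResolutionOfSingularities.Theorems.RadicialJungCleanModelsCleanLU3CompositeFormOneLift
import Summits.ResolutionOfSingularities.ResolutionOfSingularities.Theorems.RadicialJungCleanModelsCleanPatchingDefs
import Literature.AlgebraicGeometry.Resolution.RegularLocalRingsUFD
import HarnessLib

/-!
# Route `RadicialJung`, crux `CleanModels` (stmt-15917), stub `stub_cleanLU3DefectNonDiscrete`, sub-line (C-div): preliminaries of the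
# LIFT LEMMA — the prime cutting out the coarse centre, lifting a regular system of parameters from the residue surface, curve blow-ups
# inside the divisor that do not change the residue image, and the packaging of form (1)

Line `Sketch` rev 24 of crux stmt-ResolutionOfSingularities-15917; lead `res-B-lead-1` g4 (workfile `Lines/Sketch_Cdiv_assembly.lean` v2,
piece LIFT LEMMA, first half; memo `Lines/Sketch-memo-Cdiv-lift.md` §2).  OURS; nothing here proves resolution in characteristic `p`.

* `exists_prime_centre` — in a regular `R ⊆ O₁ ⊆ locAtCentre R O₁` (UFD) with non-zero coarse centre there is a PRIME `π` with `v₁ π < 1`;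
  `residue_eq_zero_iff_dvd` — it generates the kernel of the residue map (✓ `valuation_eq_one_of_not_dvd`).
* `maximalIdeal_eq_span_of_residue` — if the residue image of `R` is a local ring whose maximal ideal is generated by `res x, res y`, then
  `𝔪_R = (π, x, y)`.
* `residueImage_closure_union_singleton_deep` — adjoining an element of `𝔪₁` does not change the residue image; hence
  `exists_model_rsop_div_pow_im` — ✓ `exists_model_rsop_div_pow` (blow-ups of the curve `(t, t₂)`) with the residue image unchanged.
* `looseCleanForm_of_unit_mul_monomial` — `u · t₂^a t₃^b` with `(a, b) ≠ 0`, each exponent `0` or prime to `p`, is loosely clean of form (1).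
-/

noncomputable section

set_option linter.dupNamespace false -- mandated namespace of this single-conjunct summit

open IsLocalRing
open Literature.AlgebraicGeometry.Resolution

namespace Summit.ResolutionOfSingularities.ResolutionOfSingularities.Theorems.RadicialJung.CleanModels

variable {K : Type} [Field K] {k : Type} [Field k] [Algebra k K]

/-- **A prime cutting out the coarse centre**: for `R ⊆ O₁` regular (a UFD) whose centre of `O₁` is non-zero, some prime element `π` of `R`
has `v₁ π < 1`. [folklore] -/
theorem exists_prime_centre (O₁ : ValuationSubring K) (R : Subring K) [IsRegularLocalRing R] (hRO₁ : R ≤ O₁.toSubring)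
    (hne : ∃ r : R, r ≠ 0 ∧ O₁.valuation (r : K) < 1) :
    ∃ π : R, Prime π ∧ O₁.valuation (π : K) < 1 := by
  haveI : UniqueFactorizationMonoid R := IsRegularLocalRing.uniqueFactorizationMonoid R
  have hprime : (subringCentre R O₁ hRO₁).IsPrime := by rw [subringCentre_eq]; infer_instance
  have hmem : ∀ r : R, r ∈ subringCentre R O₁ hRO₁ ↔ O₁.valuation (r : K) < 1 := by
    intro r
    rw [subringCentre_eq, Ideal.mem_comap, ValuationSubring.valuation_lt_one_iff]
    rfl
  obtain ⟨r, hr0, hr⟩ := hne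
  have hbot : subringCentre R O₁ hRO₁ ≠ ⊥ := by
    intro h
    have : r ∈ subringCentre R O₁ hRO₁ := (hmem r).mpr hr
    rw [h, Ideal.mem_bot] at this
    exact hr0 this
  obtain ⟨π, hπ, hπp⟩ := hprime.exists_mem_prime_of_ne_bot hbot
  exact ⟨π, hπp, (hmem π).mp hπ⟩

/-- **The prime generates the kernel of the residue map**: with `R ⊆ O₁ ⊆ locAtCentre R O₁`, `π ∈ R` prime and `v₁ π < 1`, an element of
`R` has residue `0` in `κ(O₁)` iff `π` divides it. [folklore] -/
theorem residue_eq_zero_iff_dvd (O₁ : ValuationSubring K) (R : Subring K) (hRO₁ : R ≤ O₁.toSubring)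
    (hloc : O₁.toSubring ≤ locAtCentre R O₁) (π : R) (hπ : Prime π) (hvπ : O₁.valuation (π : K) < 1) (r : R) :
    residue O₁ ⟨(r : K), hRO₁ r.2⟩ = 0 ↔ π ∣ r := by
  rw [residue_eq_zero_iff, ValuationSubring.valuation_lt_one_iff]
  change O₁.valuation (r : K) < 1 ↔ _
  constructor
  · intro hlt
    by_contra hnd
    have := valuation_eq_one_of_not_dvd O₁ R hRO₁ hloc π hπ hvπ r hnd
    rw [this] at hlt
    exact lt_irrefl _ hlt
  · rintro ⟨c, hc⟩
    have hcle : O₁.valuation ((c : R) : K) ≤ 1 := (O₁.valuation_le_one_iff _).mpr (hRO₁ c.2)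
    have : (r : K) = ((π : R) : K) * ((c : R) : K) := by rw [hc]; rfl
    rw [this, map_mul]
    calc O₁.valuation ((π : R) : K) * O₁.valuation ((c : R) : K) ≤ O₁.valuation ((π : R) : K) * 1 := by gcongr
      _ < 1 := by rw [mul_one]; exact hvπ

/-- **Lifting a regular system of parameters from the residue surface**: `R ⊆ O` local with `𝔪_R = {v < 1}`, residue image `S̄ = im R` a
local ring dominated by `Ō` with `𝔪_{S̄}` generated by `res x, res y` (`x, y ∈ R`), and `π ∈ R` generating the kernel of the residue map:
then `𝔪_R = (π, x, y)`. [folklore] -/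
theorem maximalIdeal_eq_span_of_residue (O O₁ : ValuationSubring K) (h : O ≤ O₁) (R : Subring K) [IsLocalRing R]
    (hRO : R ≤ O.toSubring) (hRm : ∀ r : R, r ∈ maximalIdeal R ↔ O.valuation (r : K) < 1)
    (π : R) (hvπ : O₁.valuation (π : K) < 1)
    (hker : ∀ r : R, residue O₁ ⟨(r : K), h (hRO r.2)⟩ = 0 → π ∣ r)
    (S : Subring (ResidueField O₁)) [IsLocalRing S]
    (hdom : SubringDominates S (residueValuationSubring O O₁ h).toSubring)
    (himm : (R.comap O₁.toSubring.subtype).map (residue O₁) = S)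
    (x y : R) (hxS : residue O₁ ⟨(x : K), h (hRO x.2)⟩ ∈ S) (hyS : residue O₁ ⟨(y : K), h (hRO y.2)⟩ ∈ S)
    (hS : maximalIdeal S = Ideal.span {⟨_, hxS⟩, ⟨_, hyS⟩}) :
    maximalIdeal R = Ideal.span {π, x, y} := by
  have hRO₁ : R ≤ O₁.toSubring := fun z hz => h (hRO hz)
  have hSm : ∀ s : S, s ∈ maximalIdeal S ↔ (residueValuationSubring O O₁ h).valuation (s : ResidueField O₁) < 1 :=
    (subringDominates_valuationSubring_iff hdom.1).mp hdom
  -- `x, y, π ∈ 𝔪_R`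
  have hmemR : ∀ {z : R}, (⟨residue O₁ ⟨(z : K), hRO₁ z.2⟩, himm ▸ residue_mem_residueImage O₁ R hRO₁ z.2⟩ : S) ∈ maximalIdeal S →
      z ∈ maximalIdeal R := by
    intro z hz
    rw [hSm] at hz
    change (residueValuationSubring O O₁ h).valuation (residue O₁ ⟨(z : K), _⟩) < 1 at hz
    rw [hRm]
    exact (residue_valuation_lt_one_iff O O₁ h (hRO z.2)).mp hz
  have hxm : x ∈ maximalIdeal R := hmemR (by
    have : (⟨residue O₁ ⟨(x : K), hRO₁ x.2⟩, _⟩ : S) = ⟨_, hxS⟩ := rfl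
    rw [this, hS]; exact Ideal.subset_span (Or.inl rfl))
  have hym : y ∈ maximalIdeal R := hmemR (by
    have : (⟨residue O₁ ⟨(y : K), hRO₁ y.2⟩, _⟩ : S) = ⟨_, hyS⟩ := rfl
    rw [this, hS]; exact Ideal.subset_span (Or.inr rfl))
  have hπm : π ∈ maximalIdeal R := by
    rw [hRm]; exact valuation_lt_one_of_coarse_lt_one O O₁ h hvπ
  apply le_antisymm
  · intro r hr
    -- `res r ∈ 𝔪_S = (x̄, ȳ)`
    have hres : (⟨residue O₁ ⟨(r : K), hRO₁ r.2⟩, himm ▸ residue_mem_residueImage O₁ R hRO₁ r.2⟩ : S) ∈ maximalIdeal S := by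
      rw [hSm]
      change (residueValuationSubring O O₁ h).valuation (residue O₁ ⟨(r : K), _⟩) < 1
      by_cases hr₁ : O₁.valuation (r : K) < 1
      · have : residue O₁ ⟨(r : K), hRO₁ r.2⟩ = 0 := by
          rw [residue_eq_zero_iff]; exact (O₁.valuation_lt_one_iff _).mpr hr₁
        rw [this, map_zero]; exact zero_lt_one
      · exact (residue_valuation_lt_one_iff O O₁ h (hRO r.2)).mpr ((hRm r).mp hr)
    rw [hS, Ideal.mem_span_insert] at hres
    obtain ⟨aa, w, hw, hrw⟩ := hres
    rw [Ideal.mem_span_singleton] at hw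
    obtain ⟨bb, rfl⟩ := hw
    -- lift the coefficients
    obtain ⟨a, ha, har⟩ := (mem_residueImage_iff O₁ R hRO₁ _).mp (himm ▸ aa.2 : (aa : ResidueField O₁) ∈ _)
    obtain ⟨b, hb, hbr⟩ := (mem_residueImage_iff O₁ R hRO₁ _).mp (himm ▸ bb.2 : (bb : ResidueField O₁) ∈ _)
    have hzero : residue O₁ ⟨((r - (⟨a, ha⟩ * x + ⟨b, hb⟩ * y) : R) : K), hRO₁ (r - (⟨a, ha⟩ * x + ⟨b, hb⟩ * y)).2⟩ = 0 := by
      have e1 : residue O₁ ⟨((r - (⟨a, ha⟩ * x + ⟨b, hb⟩ * y) : R) : K), hRO₁ (r - (⟨a, ha⟩ * x + ⟨b, hb⟩ * y)).2⟩ =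
          residue O₁ ⟨(r : K), hRO₁ r.2⟩ - (residue O₁ ⟨a, hRO₁ ha⟩ * residue O₁ ⟨(x : K), hRO₁ x.2⟩ +
            residue O₁ ⟨b, hRO₁ hb⟩ * residue O₁ ⟨(y : K), hRO₁ y.2⟩) := by
        rw [← map_mul, ← map_mul, ← map_add, ← map_sub]; rfl
      rw [e1, sub_eq_zero]
      have := congrArg Subtype.val hrw
      simp only [Subring.coe_add, Subring.coe_mul] at this
      rw [har, hbr, this]
      ring
    obtain ⟨c, hc⟩ := hker _ hzero
    have : r = π * c + (⟨a, ha⟩ * x + ⟨b, hb⟩ * y) := by rw [← hc]; ring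
    rw [this]
    refine Ideal.add_mem _ (Ideal.mul_mem_right _ _ (Ideal.subset_span (Or.inl rfl))) (Ideal.add_mem _ ?_ ?_)
    · exact Ideal.mul_mem_left _ _ (Ideal.subset_span (Or.inr (Or.inl rfl)))
    · exact Ideal.mul_mem_left _ _ (Ideal.subset_span (Or.inr (Or.inr rfl)))
  · rw [Ideal.span_le]
    rintro z (rfl | rfl | rfl)
    · exact hπm
    · exact hxm
    · exact hym

/-- **Adjoining an element of `𝔪₁` does not change the residue image**: for `B ⊆ O` and `z ∈ O` with `v₁ z < 1`,
`im (B[z]) = im B`. [folklore] -/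
theorem residueImage_closure_union_singleton_deep (O O₁ : ValuationSubring K) (h : O ≤ O₁) (B : Subring K)
    (hBO : B ≤ O.toSubring) (z : K) (hzO : z ∈ O) (hz : O₁.valuation z < 1) :
    ((Subring.closure ((B : Set K) ∪ {z})).comap O₁.toSubring.subtype).map (residue O₁) =
      (B.comap O₁.toSubring.subtype).map (residue O₁) := by
  have hBO₁ : B ≤ O₁.toSubring := fun w hw => h (hBO hw)
  have hS : ((B : Set K) ∪ {z}) ⊆ O₁ := by
    rintro w (hw | rfl)
    · exact hBO₁ hw
    · exact h hzO
  rw [residueImage_closure O₁ _ hS]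
  have hz0 : residue O₁ ⟨z, h hzO⟩ = 0 := by
    rw [residue_eq_zero_iff]; exact (O₁.valuation_lt_one_iff _).mpr hz
  apply le_antisymm
  · rw [Subring.closure_le]
    rintro _ ⟨w, hw, rfl⟩
    rcases hw with hw | hw
    · exact ⟨w, hw, rfl⟩
    · have : w = ⟨z, h hzO⟩ := Subtype.ext hw
      rw [this]
      change residue O₁ ⟨z, h hzO⟩ ∈ _
      rw [hz0]; exact Subring.zero_mem _
  · rintro _ ⟨w, hw, rfl⟩
    exact Subring.subset_closure ⟨w, Or.inl hw, rfl⟩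

/-- **Blow-ups of the curve `(t, t₂)` do not change the residue image** — ✓ `exists_model_rsop_div_pow` with the residue image along a
coarsening `O₁ ≥ O` (for which `v₁ t < 1`) carried along: the new local ring has the same image `locAtCentre (im A₁) Ō` in `κ(O₁)`. [folklore] -/
theorem exists_model_rsop_div_pow_im (O O₁ : ValuationSubring K) (hOO₁ : O ≤ O₁) (A : Subalgebra k K) (hAfg : A.FG) [IsFractionRing A K]
    (hzd : ∀ (T : Subring K) (hT : T ≤ O.toSubring), A.toSubring ≤ T → (subringCentre T O hT).IsMaximal)
    (hdimA : ringKrullDim A = 3) :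
    ∀ (n : ℕ) (A₁ : Subalgebra k K) (_ : A ≤ A₁) (_ : A₁.FG) (hA₁O : A₁.toSubring ≤ O.toSubring)
      (_ : IsRegularLocalRing (locAtCentre A₁.toSubring O))
      (t t₂ t₃ : K) (ht : t ∈ locAtCentre A₁.toSubring O) (ht₂ : t₂ ∈ locAtCentre A₁.toSubring O)
      (ht₃ : t₃ ∈ locAtCentre A₁.toSubring O),
      (haveI := isLocalRing_locAtCentre hA₁O; maximalIdeal (locAtCentre A₁.toSubring O)) =
        Ideal.span {⟨t, ht⟩, ⟨t₂, ht₂⟩, ⟨t₃, ht₃⟩} →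
      (∀ m : ℕ, O.valuation t < O.valuation (t₂ ^ (m + 1))) → O₁.valuation t < 1 → O₁.valuation t₂ = 1 →
      ∃ (A₂ : Subalgebra k K), A ≤ A₂ ∧ A₂.FG ∧ ∃ (hA₂O : A₂.toSubring ≤ O.toSubring),
        IsRegularLocalRing (locAtCentre A₂.toSubring O) ∧ locAtCentre A₁.toSubring O ≤ locAtCentre A₂.toSubring O ∧
        ((locAtCentre A₂.toSubring O).comap O₁.toSubring.subtype).map (residue O₁) =
          ((locAtCentre A₁.toSubring O).comap O₁.toSubring.subtype).map (residue O₁) ∧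
        ∃ (h₁ : t / t₂ ^ n ∈ locAtCentre A₂.toSubring O) (h₂ : t₂ ∈ locAtCentre A₂.toSubring O)
          (h₃ : t₃ ∈ locAtCentre A₂.toSubring O),
          (haveI := isLocalRing_locAtCentre hA₂O; maximalIdeal (locAtCentre A₂.toSubring O)) =
            Ideal.span {⟨_, h₁⟩, ⟨_, h₂⟩, ⟨_, h₃⟩} := by
  intro n
  induction n with
  | zero =>
    intro A₁ hAA₁ hA₁fg hA₁O hreg₁ t t₂ t₃ ht ht₂ ht₃ hmax _ _ _
    refine ⟨A₁, hAA₁, hA₁fg, hA₁O, hreg₁, le_rfl, rfl, ?_, ht₂, ht₃, ?_⟩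
    · rw [pow_zero, div_one]; exact ht
    · refine hmax.trans ?_
      congr 2
      apply Subtype.ext
      change t = t / t₂ ^ 0
      rw [pow_zero, div_one]
  | succ n ih =>
    intro A₁ hAA₁ hA₁fg hA₁O hreg₁ t t₂ t₃ ht ht₂ ht₃ hmax hdeep hv₁t hv₁t₂
    obtain ⟨A₂, hAA₂, hA₂fg, hA₂O, hreg₂, h12, him₂, h₁, h₂, h₃, hmax₂⟩ :=
      ih A₁ hAA₁ hA₁fg hA₁O hreg₁ t t₂ t₃ ht ht₂ ht₃ hmax hdeep hv₁t hv₁t₂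
    set R₂ := locAtCentre A₂.toSubring O with hR₂
    haveI := hreg₂
    have hdimA₂ : ringKrullDim (locAtCentre A₂.toSubring O) = 3 := by
      rw [ringKrullDim_locAtCentre_eq_of_isMaximal A₂ hA₂fg O hA₂O (hzd _ hA₂O (fun z hz => hAA₂ hz)),
        ringKrullDim_eq_of_fg_of_le hAfg hA₂fg hAA₂, hdimA]
    have hd : (maximalIdeal R₂).spanFinrank = 3 := spanFinrank_eq_three_of_dim R₂ hdimA₂
    have hR₂O : R₂ ≤ O.toSubring := locAtCentre_le hA₂O
    have hdom₂ : SubringDominates R₂ O.toSubring := subringDominates_locAtCentre hA₂O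
    have ht₂0 : t₂ ≠ 0 := by
      intro h0; have := hdeep 0; rw [h0, zero_pow (by norm_num), map_zero] at this; exact not_lt.mpr zero_le this
    have hv : O.valuation ((⟨t / t₂ ^ n, h₁⟩ : R₂) : K) < O.valuation ((⟨t₂, h₂⟩ : R₂) : K) := by
      change O.valuation (t / t₂ ^ n) < O.valuation t₂
      rw [map_div₀, map_pow, div_lt_iff₀ (pow_pos (zero_lt_iff.mpr ((Valuation.ne_zero_iff _).mpr ht₂0)) n), ← pow_succ',
        ← map_pow]
      exact hdeep n
    have hspan : Ideal.span {(⟨t / t₂ ^ n, h₁⟩ : R₂), ⟨t₂, h₂⟩, ⟨t₃, h₃⟩} = maximalIdeal R₂ := hmax₂.symm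
    obtain ⟨R', hR'eq, h2R', hR'O, hreg', -, g₁, g₂, g₃, hmax'⟩ :=
      curveChart_step O R₂ hR₂O hdom₂ hd ⟨_, h₁⟩ ⟨_, h₂⟩ ⟨_, h₃⟩ hspan hv
    have hlb : IsLocalBlowup O R₂ R' := by
      refine ⟨hR₂O, {t / t₂ ^ n / t₂}, ?_, ?_⟩
      · intro z hz
        rw [Finset.coe_singleton, Set.mem_singleton_iff] at hz
        rw [hz]
        exact hR'O g₁
      · rw [Finset.coe_singleton]; exact hR'eq
    obtain ⟨A₃, hA₃O, hAA₃, hA₃fg, hR'A₃⟩ := exists_model_of_isLocalBlowup hAA₂ hA₂fg hlb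
    -- the residue image is unchanged: the new generator lies in `𝔪₁`
    have hzO : t / t₂ ^ n / t₂ ∈ O := hR'O g₁
    have hz₁ : O₁.valuation (t / t₂ ^ n / t₂) < 1 := by
      rw [map_div₀, map_div₀, map_pow, hv₁t₂, one_pow, div_one, div_one]; exact hv₁t
    have him' : (R'.comap O₁.toSubring.subtype).map (residue O₁) = (R₂.comap O₁.toSubring.subtype).map (residue O₁) := by
      rw [hR'eq, residueImage_locAtCentre O O₁ hOO₁ _ (curveChart_le O R₂ hR₂O _ _ hv.le),
        residueImage_closure_union_singleton_deep O O₁ hOO₁ R₂ hR₂O _ hzO hz₁, hR₂,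
        residueImage_locAtCentre O O₁ hOO₁ _ hA₂O, locAtCentre_locAtCentre]
    subst hR'A₃
    refine ⟨A₃, hAA₃, hA₃fg, hA₃O, hreg', h12.trans h2R', him'.trans him₂, ?_, g₂, g₃, ?_⟩
    · have : t / t₂ ^ (n + 1) = t / t₂ ^ n / t₂ := by rw [pow_succ, div_div]
      rw [this]; exact g₁
    · refine hmax'.trans ?_
      congr 2
      apply Subtype.ext
      change t / t₂ ^ n / t₂ = t / t₂ ^ (n + 1)
      rw [pow_succ, div_div]

/-- **Packaging form (1)**: in a regular local `R ⊆ K` of dimension `3` with regular system of parameters `(t₁, t₂, t₃)`, an element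
`X = u · t₂^a · t₃^b` with `u` a unit, `(a, b) ≠ (0, 0)` and each of `a, b` zero or prime to `p` is loosely clean of form (1). [folklore] -/
theorem looseCleanForm_of_unit_mul_monomial (p : ℕ) (R : Subring K) [IsRegularLocalRing R] (hdim : ringKrullDim R = 3)
    (t₁ t₂ t₃ : R) (hmax : maximalIdeal R = Ideal.span {t₁, t₂, t₃}) (u : R) (hu : IsUnit u) (a b : ℕ)
    (hab : a ≠ 0 ∨ b ≠ 0) (ha : a = 0 ∨ ¬ p ∣ a) (hb : b = 0 ∨ ¬ p ∣ b) (X : K)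
    (hX : X = (u : K) * (t₂ : K) ^ a * (t₃ : K) ^ b) :
    LooseCleanForm p R.subtype X := by
  classical
  have hdim' : ringKrullDim R = ((3 : ℕ) : WithBot ℕ∞) := by rw [hdim]; rfl
  -- two orderings of the regular system of parameters
  have hspan₂ : Ideal.span (Set.range ![t₂, t₃, t₁]) = maximalIdeal R := by
    rw [range_vec3, hmax, Set.insert_comm t₁ t₂, Set.pair_comm t₁ t₃]
  have hspan₃ : Ideal.span (Set.range ![t₃, t₂, t₁]) = maximalIdeal R := by
    rw [range_vec3, hmax, Set.pair_comm t₂ t₃, Set.insert_comm t₁ t₃, Set.pair_comm t₁ t₂]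
  left
  by_cases ha0 : a = 0
  · -- `X = u t₃^b`, `b ≠ 0` prime to `p`
    have hb0 : b ≠ 0 := hab.resolve_left (not_not.mpr ha0)
    have hbp : ¬ p ∣ b := hb.resolve_left hb0
    refine ⟨3, 1, by norm_num, ![t₃, t₂, t₁], ![b], u, hu, hspan₃, hdim', Nat.one_pos, ?_, ?_⟩
    · intro i; fin_cases i; exact hbp
    · rw [hX, ha0, pow_zero, mul_one, map_mul, Fin.prod_univ_one]
      simp [Fin.castLE]
  · have hap : ¬ p ∣ a := ha.resolve_left ha0
    by_cases hb0 : b = 0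
    · refine ⟨3, 1, by norm_num, ![t₂, t₃, t₁], ![a], u, hu, hspan₂, hdim', Nat.one_pos, ?_, ?_⟩
      · intro i; fin_cases i; exact hap
      · rw [hX, hb0, pow_zero, mul_one, map_mul, Fin.prod_univ_one]
        simp [Fin.castLE]
    · have hbp : ¬ p ∣ b := hb.resolve_left hb0
      refine ⟨3, 2, by norm_num, ![t₂, t₃, t₁], ![a, b], u, hu, hspan₂, hdim', Nat.succ_pos 1, ?_, ?_⟩
      · intro i; fin_cases i
        · exact hap
        · exact hbp
      · rw [hX, map_mul, Fin.prod_univ_two]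
        simp [Fin.castLE, mul_assoc]

end Summit.ResolutionOfSingularities.ResolutionOfSingularities.Theorems.RadicialJung.CleanModels

end
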